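import Mathlib
import HarnessLib

/-!
# The analytic branch at a regular singular point, I: the Frobenius recursion for
# `x v′ = M(x) v + g(x)`, its majorant, and the calculus of vector power series `Σ xⁿ • wₙ`

Topic `Literature/Analysis/ODE` (namespace `Literature.Analysis.ODE`). The local theory of a linear ANALYTIC
system with a singularity of the first kind (regular singular point) at `x = 0`,

  `x v′(x) = M(x) v(x) + g(x)`,  `M(x) = Σₖ xᵏ • Mₖ ∈ L(E)`,  `g(x) = Σₖ xᵏ • gₖ ∈ E`,

over `𝕜 = ℝ` or `ℂ` (`RCLike 𝕜`), `E` a Banach space (e.g. `Fin d → 𝕜`): the ANALYTIC BRANCH through a prescribed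
value `v(0) = v₀` (Frobenius exponent `0`). Inserting `v = Σ xⁿ • vₙ` gives `(n − M₀) vₙ = Σ_{k<n} M_{n−k} v_k + gₙ`
(`n ≥ 1`) and the compatibility condition `M₀ v₀ + g₀ = 0` at order `0`. NON-RESONANCE (no positive integer is an
eigenvalue of `M₀`) is taken in the quantitative form that applications certify: for every `n ≥ 1` an inverse `Rₙ`
of `n − M₀` with `‖Rₙ‖ ≤ c/n`. This file (part I) contains the algebra and the estimates; part II
(`RegularSingularAnalyticBranchSolution.lean`) sums the series and proves the equation and analyticity.

* `frobeniusCoeff M g R v₀` — THE RECURSION `v₀`, `vₙ = Rₙ (Σ_{k<n} M_{n−k} v_k + gₙ)`; its cleared form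
  (`frobeniusCoeff_rec`; `frobeniusCoeff_antidiagonal`: `n vₙ = Σ_{k+l=n} M_k v_l + gₙ` for ALL `n`, given
  `M₀ v₀ + g₀ = 0`) and FORMAL UNIQUENESS (`frobeniusCoeff_unique`: a coefficient sequence with `w₀ = v₀` solving
  the cleared recursion is this one, when `Rₙ` is a left inverse);
* `norm_frobeniusCoeff_le` — THE MAJORANT: if `‖Mₖ‖ ≤ K aᵏ`, `‖gₖ‖ ≤ G aᵏ` (`k ≥ 1`) and `‖Rₙ‖ ≤ c/n` (`n ≥ 1`),
  then `‖vₙ‖ ≤ B λⁿ` with `λ = a (1 + 2cK)` for every `B ≥ max (‖v₀‖, 2cG)` — LINEAR in the data `(v₀, g)` (a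
  resolvent bound) and depending on `(a, K, G, c)` only, hence uniform in parameters (proof: strong induction and the
  telescoping identity `2cK Σ_{k<n} a^{n−k} λᵏ = λⁿ − aⁿ`, `frobenius_majorant_telescope`); radius `≥ 1/λ`;
* the calculus of vector power series `Σ xⁿ • wₙ` with `‖wₙ‖ ≤ B λⁿ` on `λ‖x‖ < 1`: absolute convergence
  (`summable_norm_pow_smul`), value at `0`, sup bound `B/(1 − λ‖x‖)` (`norm_tsum_pow_smul_le`), TERM-WISE
  DIFFERENTIATION (`hasDerivAt_tsum_pow_smul`), the CAUCHY PRODUCT of an operator series with a vector series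
  (`hasSum_sum_antidiagonal_apply`: absolute summability of the product family, fibrewise evaluation), and the
  packaging as a `FormalMultilinearSeries` (`coeffSeries w`, radius `le_radius_coeffSeries`, analyticity
  `hasFPowerSeriesOnBall_tsum_pow_smul`).

NOT here: the second (singular, `x^{−ν}` / logarithmic) Frobenius branch; resonant cases; uniqueness among `C¹`/`C^∞`
(rather than analytic / formal) solutions.

## References
* E. A. Coddington, N. Levinson, *Theory of Ordinary Differential Equations*, McGraw–Hill 1955, Ch. 4
  (linear systems with a singularity of the first kind: the recursion `(n − M₀)vₙ = …` and its majorant).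
  Key `CoddingtonLevinson1955`.
* P. Hartman, *Ordinary Differential Equations*, SIAM Classics 38 (2002), Ch. IV §§11–12 ((12.12): the method of
  undetermined coefficients at a regular singular point). Key `Hartman2002`.
* W. Wasow, *Asymptotic Expansions for Ordinary Differential Equations*, Interscience 1965, Ch. II §5.
  Key `Wasow1965`.
-/

noncomputable section

open Finset Filter Metric
open scoped Topology NNReal ENNReal

namespace Literature.Analysis.ODE

variable {𝕜 : Type*} [RCLike 𝕜] {E : Type*} [NormedAddCommGroup E] [NormedSpace 𝕜 E]

/-! ### The Frobenius recursion -/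

/-- **The Frobenius coefficients** of the analytic branch of `x v′ = M(x) v + g(x)` through `v(0) = v₀`:
`v₀`, and `vₙ = Rₙ (Σ_{k<n} M_{n−k} v_k + gₙ)` for `n ≥ 1`, where `Rₙ` is the supplied inverse of `n − M₀`.
[cite: Hartman2002, Ch. IV §12 (12.12)] -/
def frobeniusCoeff (M : ℕ → E →L[𝕜] E) (g : ℕ → E) (R : ℕ → E →L[𝕜] E) (v₀ : E) (n : ℕ) : E :=
  if n = 0 then v₀ else R n (∑ k : Fin n, M (n - k) (frobeniusCoeff M g R v₀ k) + g n)

section Recursion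

variable (M : ℕ → E →L[𝕜] E) (g : ℕ → E) (R : ℕ → E →L[𝕜] E) (v₀ : E)

/-- The zeroth coefficient is the prescribed value `v₀`. [folklore] -/
@[simp] theorem frobeniusCoeff_zero : frobeniusCoeff M g R v₀ 0 = v₀ := by
  rw [frobeniusCoeff]
  exact if_pos rfl

/-- The recursion for `n ≠ 0`: `vₙ = Rₙ (Σ_{k<n} M_{n−k} v_k + gₙ)`. [folklore] -/
theorem frobeniusCoeff_of_ne_zero {n : ℕ} (hn : n ≠ 0) :
    frobeniusCoeff M g R v₀ n = R n (∑ k ∈ range n, M (n - k) (frobeniusCoeff M g R v₀ k) + g n) := by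
  rw [frobeniusCoeff, if_neg hn, Finset.sum_range]

variable {M R}

/-- The recursion in CLEARED form: if `Rₙ` is a right inverse of `n − M₀` (`n ≥ 1`), then
`n vₙ − M₀ vₙ = Σ_{k<n} M_{n−k} v_k + gₙ`. [folklore] -/
theorem frobeniusCoeff_rec (hR : ∀ n : ℕ, 1 ≤ n → ∀ w : E, (n : 𝕜) • R n w - M 0 (R n w) = w) {n : ℕ}
    (hn : 1 ≤ n) :
    (n : 𝕜) • frobeniusCoeff M g R v₀ n - M 0 (frobeniusCoeff M g R v₀ n) =
      ∑ k ∈ range n, M (n - k) (frobeniusCoeff M g R v₀ k) + g n := by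
  rw [frobeniusCoeff_of_ne_zero M g R v₀ (by omega)]
  exact hR n hn _

variable {g v₀}

/-- The recursion in ANTIDIAGONAL form, all orders at once: with the compatibility condition `M₀ v₀ + g₀ = 0`,
`n vₙ = Σ_{k+l=n} M_k v_l + gₙ` for every `n` (the coefficient identity of `x v′ = M v + g`). [folklore] -/
theorem frobeniusCoeff_antidiagonal (hR : ∀ n : ℕ, 1 ≤ n → ∀ w : E, (n : 𝕜) • R n w - M 0 (R n w) = w)
    (h0 : M 0 v₀ + g 0 = 0) (n : ℕ) :
    (n : 𝕜) • frobeniusCoeff M g R v₀ n =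
      ∑ kl ∈ antidiagonal n, M kl.1 (frobeniusCoeff M g R v₀ kl.2) + g n := by
  rcases Nat.eq_zero_or_pos n with rfl | hn
  · simpa using h0.symm
  · have hrec := frobeniusCoeff_rec g v₀ hR hn
    rw [sub_eq_iff_eq_add] at hrec
    rw [← Nat.sum_antidiagonal_swap]
    simp only [Prod.fst_swap, Prod.snd_swap]
    rw [Nat.sum_antidiagonal_eq_sum_range_succ (fun i j => M j (frobeniusCoeff M g R v₀ i)),
      Finset.sum_range_succ, Nat.sub_self, hrec]
    abel

/-- FORMAL UNIQUENESS: if `Rₙ` is a left inverse of `n − M₀` (`n ≥ 1`), any coefficient sequence `w` with `w₀ = v₀`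
solving the cleared recursion `n wₙ − M₀ wₙ = Σ_{k<n} M_{n−k} w_k + gₙ` is the Frobenius sequence. [folklore] -/
theorem frobeniusCoeff_unique (hR' : ∀ n : ℕ, 1 ≤ n → ∀ w : E, R n ((n : 𝕜) • w - M 0 w) = w) {w : ℕ → E}
    (hw0 : w 0 = v₀) (hw : ∀ n : ℕ, 1 ≤ n → (n : 𝕜) • w n - M 0 (w n) = ∑ k ∈ range n, M (n - k) (w k) + g n) :
    w = frobeniusCoeff M g R v₀ := by
  funext n
  induction n using Nat.strong_induction_on with | _ n ih => ?_
  rcases Nat.eq_zero_or_pos n with rfl | hn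
  · rw [hw0, frobeniusCoeff_zero]
  · have hs : ∑ k ∈ range n, M (n - k) (w k) = ∑ k ∈ range n, M (n - k) (frobeniusCoeff M g R v₀ k) :=
      Finset.sum_congr rfl fun k hk => by rw [ih k (mem_range.1 hk)]
    rw [frobeniusCoeff_of_ne_zero M g R v₀ hn.ne', ← hs, ← hw n hn, hR' n hn]

end Recursion

/-! ### The majorant -/

/-- The telescoping identity behind the majorant: `2cK · Σ_{k<n} a^{n−k} λᵏ = λⁿ − aⁿ` for `λ = a(1 + 2cK)`. [folklore] -/
theorem frobenius_majorant_telescope (a c K : ℝ) (n : ℕ) :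
    2 * c * K * ∑ k ∈ range n, a ^ (n - k) * (a * (1 + 2 * c * K)) ^ k =
      (a * (1 + 2 * c * K)) ^ n - a ^ n := by
  set lam := a * (1 + 2 * c * K) with hlam
  have hS : ∑ k ∈ range n, a ^ (n - k) * lam ^ k = a * ∑ k ∈ range n, lam ^ k * a ^ (n - 1 - k) := by
    rw [Finset.mul_sum]
    refine Finset.sum_congr rfl fun k hk => ?_
    have hk' : n - k = (n - 1 - k) + 1 := by have := mem_range.1 hk; omega
    rw [hk', pow_succ]
    ring
  rw [hS, ← geom_sum₂_mul, hlam]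
  ring

/-- **THE MAJORANT.** If `‖Mₖ‖ ≤ K aᵏ` and `‖gₖ‖ ≤ G aᵏ` for `k ≥ 1`, `‖Rₙ‖ ≤ c/n` for `n ≥ 1` (`a, K, G, c ≥ 0`), then for
every `B` with `‖v₀‖ ≤ B` and `2cG ≤ B` the Frobenius coefficients obey `‖vₙ‖ ≤ B λⁿ`, `λ = a (1 + 2cK)`: the analytic
branch converges on `‖x‖ < 1/λ` with a bound LINEAR in the data `(v₀, g)`. (Strong induction:
`‖vₙ‖ ≤ (c/n)(K B Σ_{k<n} a^{n−k}λᵏ + G aⁿ) ≤ (B/2)(λⁿ − aⁿ) + (B/2) aⁿ ≤ B λⁿ`.)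
[cite: CoddingtonLevinson1955, Ch. 4] -/
theorem norm_frobeniusCoeff_le {M : ℕ → E →L[𝕜] E} {g : ℕ → E} {R : ℕ → E →L[𝕜] E} {v₀ : E}
    {a K G c B : ℝ} (ha : 0 ≤ a) (hK : 0 ≤ K) (hG : 0 ≤ G) (hc : 0 ≤ c)
    (hM : ∀ k : ℕ, 1 ≤ k → ‖M k‖ ≤ K * a ^ k) (hg : ∀ k : ℕ, 1 ≤ k → ‖g k‖ ≤ G * a ^ k)
    (hRn : ∀ n : ℕ, 1 ≤ n → ‖R n‖ ≤ c / n) (hB₀ : ‖v₀‖ ≤ B) (hB : 2 * c * G ≤ B) (n : ℕ) :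
    ‖frobeniusCoeff M g R v₀ n‖ ≤ B * (a * (1 + 2 * c * K)) ^ n := by
  induction n using Nat.strong_induction_on with | _ n ih => ?_
  rcases Nat.eq_zero_or_pos n with rfl | hn
  · simpa using hB₀
  set lam := a * (1 + 2 * c * K) with hlam
  have hB0 : 0 ≤ B := (norm_nonneg _).trans hB₀
  have hlam0 : 0 ≤ lam := by positivity
  have halam : a ≤ lam := le_mul_of_one_le_right ha (by nlinarith)
  have hn1 : (1 : ℝ) ≤ n := by exact_mod_cast hn
  set S := ∑ k ∈ range n, a ^ (n - k) * lam ^ k with hS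
  have hS0 : 0 ≤ S := Finset.sum_nonneg fun k _ => by positivity
  have key : 2 * c * K * S = lam ^ n - a ^ n := frobenius_majorant_telescope a c K n
  have hsum : ‖∑ k ∈ range n, M (n - k) (frobeniusCoeff M g R v₀ k)‖ ≤ K * B * S := by
    calc ‖∑ k ∈ range n, M (n - k) (frobeniusCoeff M g R v₀ k)‖
        ≤ ∑ k ∈ range n, ‖M (n - k) (frobeniusCoeff M g R v₀ k)‖ := norm_sum_le _ _
      _ ≤ ∑ k ∈ range n, K * a ^ (n - k) * (B * lam ^ k) := by
          refine Finset.sum_le_sum fun k hk => ?_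
          have hk := mem_range.1 hk
          calc ‖M (n - k) (frobeniusCoeff M g R v₀ k)‖ ≤ ‖M (n - k)‖ * ‖frobeniusCoeff M g R v₀ k‖ :=
                (M (n - k)).le_opNorm _
            _ ≤ K * a ^ (n - k) * (B * lam ^ k) :=
                mul_le_mul (hM _ (by omega)) (ih k hk) (norm_nonneg _) (by positivity)
      _ = K * B * S := by
          rw [hS, Finset.mul_sum]
          exact Finset.sum_congr rfl fun k _ => by ring
  calc ‖frobeniusCoeff M g R v₀ n‖
      = ‖R n (∑ k ∈ range n, M (n - k) (frobeniusCoeff M g R v₀ k) + g n)‖ := by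
        rw [frobeniusCoeff_of_ne_zero M g R v₀ hn.ne']
    _ ≤ ‖R n‖ * ‖∑ k ∈ range n, M (n - k) (frobeniusCoeff M g R v₀ k) + g n‖ := (R n).le_opNorm _
    _ ≤ c / n * (K * B * S + G * a ^ n) :=
        mul_le_mul (hRn n hn) ((norm_add_le _ _).trans (add_le_add hsum (hg n hn))) (norm_nonneg _)
          (by positivity)
    _ ≤ c * (K * B * S + G * a ^ n) := mul_le_mul_of_nonneg_right (div_le_self hc hn1) (by positivity)
    _ = B / 2 * (2 * c * K * S) + c * G * a ^ n := by ring
    _ ≤ B / 2 * lam ^ n + B / 2 * lam ^ n := by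
        refine add_le_add (mul_le_mul_of_nonneg_left ?_ (by positivity)) ?_
        · rw [key]
          linarith [pow_nonneg ha n]
        · calc c * G * a ^ n ≤ B / 2 * a ^ n := mul_le_mul_of_nonneg_right (by linarith) (pow_nonneg ha n)
            _ ≤ B / 2 * lam ^ n := mul_le_mul_of_nonneg_left (pow_le_pow_left₀ ha halam n) (by positivity)
    _ = B * lam ^ n := by ring

/-! ### Vector power series `Σ xⁿ • wₙ` with geometrically bounded coefficients -/

section Series

variable {F : Type*} [NormedAddCommGroup F] [NormedSpace 𝕜 F]

/-- Absolute convergence of `Σ xⁿ • wₙ` on `λ ‖x‖ < 1` when `‖wₙ‖ ≤ B λⁿ`. [folklore] -/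
theorem summable_norm_pow_smul {w : ℕ → F} {B lam : ℝ} (hw : ∀ n, ‖w n‖ ≤ B * lam ^ n) (hlam : 0 ≤ lam)
    {x : 𝕜} (hx : lam * ‖x‖ < 1) : Summable fun n => ‖x ^ n • w n‖ := by
  have h0 : 0 ≤ lam * ‖x‖ := by positivity
  refine .of_nonneg_of_le (fun _ => norm_nonneg _) (fun n => ?_)
    ((summable_geometric_of_lt_one h0 hx).mul_left B)
  rw [norm_smul, norm_pow, mul_pow]
  calc ‖x‖ ^ n * ‖w n‖ ≤ ‖x‖ ^ n * (B * lam ^ n) := mul_le_mul_of_nonneg_left (hw n) (by positivity)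
    _ = B * (lam ^ n * ‖x‖ ^ n) := by ring

/-- The value at `x = 0` of `Σ xⁿ • wₙ` is `w₀`. [folklore] -/
theorem tsum_pow_smul_zero (w : ℕ → F) : (∑' n, (0 : 𝕜) ^ n • w n) = w 0 := by
  rw [tsum_eq_single 0 fun n hn => by simp [zero_pow hn]]
  simp

/-- TERM-WISE DIFFERENTIATION of `Σ xⁿ • wₙ` inside `λ ‖x‖ < 1` (`‖wₙ‖ ≤ B λⁿ`): the derivative series
`Σ (n x^{n−1}) • wₙ` converges and is the derivative. [folklore] -/
theorem hasDerivAt_tsum_pow_smul [CompleteSpace F] {w : ℕ → F} {B lam : ℝ} (hw : ∀ n, ‖w n‖ ≤ B * lam ^ n)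
    (hlam : 0 ≤ lam) {x : 𝕜} (hx : lam * ‖x‖ < 1) :
    Summable (fun n : ℕ => ((n : 𝕜) * x ^ (n - 1)) • w n) ∧
      HasDerivAt (fun y : 𝕜 => ∑' n, y ^ n • w n) (∑' n : ℕ, ((n : 𝕜) * x ^ (n - 1)) • w n) x := by
  have hB : 0 ≤ B := by simpa using (norm_nonneg _).trans (hw 0)
  -- a radius `r` with `‖x‖ < r` and `lam * r < 1`
  obtain ⟨r, hxr, hr⟩ : ∃ r : ℝ, ‖x‖ < r ∧ lam * r < 1 := by
    rcases eq_or_lt_of_le hlam with h | h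
    · exact ⟨‖x‖ + 1, by linarith, by rw [← h]; simp⟩
    · refine ⟨(1 + lam * ‖x‖) / (2 * lam), ?_, ?_⟩
      · rw [lt_div_iff₀ (by positivity)]
        nlinarith
      · rw [mul_div_assoc', div_lt_one (by positivity)]
        nlinarith
  have hr0 : 0 < r := (norm_nonneg x).trans_lt hxr
  have hq0 : 0 ≤ r * lam := by positivity
  have hq1 : r * lam < 1 := by linarith [mul_comm r lam]
  -- summable majorant of the term-wise derivatives on the ball of radius `r`
  set u : ℕ → ℝ := fun n => B * lam * ((n : ℝ) * (r * lam) ^ (n - 1)) with hu_def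
  have hu : Summable u := by
    have h1 : Summable fun n : ℕ => ((n + 1 : ℕ) : ℝ) * (r * lam) ^ n := by
      have hq : ‖r * lam‖ < 1 := by rwa [Real.norm_of_nonneg hq0]
      refine ((summable_pow_mul_geometric_of_norm_lt_one 1 hq).add
        (summable_geometric_of_lt_one hq0 hq1)).congr fun n => ?_
      push_cast
      ring
    have h2 : Summable fun n : ℕ => (n : ℝ) * (r * lam) ^ (n - 1) := by
      rw [← summable_nat_add_iff 1]
      simpa using h1
    exact h2.mul_left (B * lam)
  have hg' : ∀ (n : ℕ) (y : 𝕜), y ∈ Metric.ball (0 : 𝕜) r → ‖((n : 𝕜) * y ^ (n - 1)) • w n‖ ≤ u n := by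
    intro n y hy
    rw [Metric.mem_ball, dist_zero_right] at hy
    cases n with
    | zero => simp [hu_def]
    | succ m =>
      simp only [hu_def, Nat.add_sub_cancel]
      rw [norm_smul, norm_mul, norm_pow, RCLike.norm_natCast]
      calc ((m + 1 : ℕ) : ℝ) * ‖y‖ ^ m * ‖w (m + 1)‖
          ≤ ((m + 1 : ℕ) : ℝ) * r ^ m * (B * lam ^ (m + 1)) :=
            mul_le_mul (mul_le_mul_of_nonneg_left (pow_le_pow_left₀ (norm_nonneg y) hy.le m) (by positivity))
              (hw (m + 1)) (norm_nonneg _) (by positivity)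
        _ = B * lam * (((m + 1 : ℕ) : ℝ) * (r * lam) ^ m) := by
            rw [mul_pow, pow_succ]
            ring
  have hg : ∀ (n : ℕ) (y : 𝕜), y ∈ Metric.ball (0 : 𝕜) r →
      HasDerivAt (fun y => y ^ n • w n) (((n : 𝕜) * y ^ (n - 1)) • w n) y :=
    fun n y _ => (hasDerivAt_pow n y).smul_const (w n)
  have hxt : x ∈ Metric.ball (0 : 𝕜) r := by rwa [Metric.mem_ball, dist_zero_right]
  have hsum : Summable fun n => x ^ n • w n := (summable_norm_pow_smul hw hlam hx).of_norm
  exact ⟨Summable.of_norm_bounded hu fun n => hg' n x hxt,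
    hasDerivAt_tsum_of_isPreconnected hu Metric.isOpen_ball (convex_ball (0 : 𝕜) r).isPreconnected hg hg'
      hxt hsum hxt⟩

/-- **CAUCHY PRODUCT, operator series applied to a vector series.** If `Σ Tₙ = S` in `L(F)` and `Σ wₙ = s` in `F`, both
absolutely, then `Σₙ Σ_{k+l=n} T_k w_l = S s`. [folklore] -/
theorem hasSum_sum_antidiagonal_apply [CompleteSpace F] {T : ℕ → F →L[𝕜] F} {w : ℕ → F} {S : F →L[𝕜] F}
    {s : F} (hT : HasSum T S) (hw : HasSum w s) (hTn : Summable fun n => ‖T n‖) (hwn : Summable fun n => ‖w n‖) :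
    HasSum (fun n => ∑ kl ∈ antidiagonal n, T kl.1 (w kl.2)) (S s) := by
  have hprod : Summable fun p : ℕ × ℕ => T p.1 (w p.2) := by
    refine .of_norm_bounded (summable_mul_of_summable_norm (f := fun n => ‖T n‖) (g := fun n => ‖w n‖)
      (by simpa using hTn) (by simpa using hwn)) fun p => ?_
    exact (T p.1).le_opNorm (w p.2)
  have h2 : HasSum (fun p : ℕ × ℕ => T p.1 (w p.2)) (S s) := by
    -- the sum of the product family is `S s`: fibrewise in `k` it is `Σ_k T_k s`
    have h4 : HasSum (fun k => T k s) (∑' p : ℕ × ℕ, T p.1 (w p.2)) :=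
      hprod.hasSum.prod_fiberwise fun k => (T k).hasSum hw
    have h5 : HasSum (fun k => T k s) (S s) := by
      simpa using (ContinuousLinearMap.apply 𝕜 F s).hasSum hT
    exact h4.unique h5 ▸ hprod.hasSum
  have h3 := (HasAntidiagonal.sigmaAntidiagonalEquivProd.hasSum_iff (f := fun p : ℕ × ℕ => T p.1 (w p.2))).2 h2
  refine h3.sigma fun n => ?_
  rw [← Finset.sum_coe_sort]
  exact hasSum_fintype _

end Series

/-! ### Analyticity: the Frobenius series as a `FormalMultilinearSeries` -/

/-- The formal power series `Σ xⁿ • wₙ` of a coefficient sequence `w : ℕ → F` (one variable, vector values). [folklore] -/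
def coeffSeries {F : Type*} [NormedAddCommGroup F] [NormedSpace 𝕜 F] (w : ℕ → F) : FormalMultilinearSeries 𝕜 𝕜 F :=
  fun n => ContinuousMultilinearMap.mkPiRing 𝕜 (Fin n) (w n)

section CoeffSeries

variable {F : Type*} [NormedAddCommGroup F] [NormedSpace 𝕜 F]

/-- The `n`-th term of `coeffSeries w` at `(x, …, x)` is `xⁿ • wₙ`. [folklore] -/
@[simp] theorem coeffSeries_apply (w : ℕ → F) (n : ℕ) (x : 𝕜) :
    coeffSeries w n (fun _ => x) = x ^ n • w n := by
  simp [coeffSeries, ContinuousMultilinearMap.mkPiRing_apply]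

/-- `‖coeffSeries w n‖ = ‖wₙ‖`. [folklore] -/
@[simp] theorem norm_coeffSeries (w : ℕ → F) (n : ℕ) : ‖coeffSeries (𝕜 := 𝕜) w n‖ = ‖w n‖ :=
  ContinuousMultilinearMap.norm_mkPiRing _

/-- The sum of `coeffSeries w` is `x ↦ Σ xⁿ • wₙ`. [folklore] -/
theorem coeffSeries_sum (w : ℕ → F) : (coeffSeries (𝕜 := 𝕜) w).sum = fun x => ∑' n, x ^ n • w n := by
  funext x
  simp only [FormalMultilinearSeries.sum, coeffSeries_apply]

/-- RADIUS: if `‖wₙ‖ ≤ B λⁿ` then `coeffSeries w` converges on every ball of radius `r` with `λ r ≤ 1`. [folklore] -/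
theorem le_radius_coeffSeries {w : ℕ → F} {B lam : ℝ} (hw : ∀ n, ‖w n‖ ≤ B * lam ^ n) (hlam : 0 ≤ lam)
    {r : ℝ≥0} (hr : lam * r ≤ 1) : (r : ℝ≥0∞) ≤ (coeffSeries (𝕜 := 𝕜) w).radius := by
  have hB : 0 ≤ B := by simpa using (norm_nonneg _).trans (hw 0)
  refine FormalMultilinearSeries.le_radius_of_bound _ B fun n => ?_
  rw [norm_coeffSeries]
  calc ‖w n‖ * (r : ℝ) ^ n ≤ B * lam ^ n * (r : ℝ) ^ n := mul_le_mul_of_nonneg_right (hw n) (by positivity)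
    _ = B * (lam * r) ^ n := by rw [mul_pow]; ring
    _ ≤ B * 1 := mul_le_mul_of_nonneg_left (pow_le_one₀ (by positivity) hr) hB
    _ = B := mul_one B

/-- ANALYTICITY: if `‖wₙ‖ ≤ B λⁿ`, then `x ↦ Σ xⁿ • wₙ` has `coeffSeries w` as power series on the ball of radius `r`,
for every `r > 0` with `λ r ≤ 1`. [folklore] -/
theorem hasFPowerSeriesOnBall_tsum_pow_smul [CompleteSpace F] {w : ℕ → F} {B lam : ℝ}
    (hw : ∀ n, ‖w n‖ ≤ B * lam ^ n) (hlam : 0 ≤ lam) {r : ℝ≥0} (hr0 : 0 < r) (hr : lam * r ≤ 1) :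
    HasFPowerSeriesOnBall (fun x : 𝕜 => ∑' n, x ^ n • w n) (coeffSeries w) 0 r := by
  have hle := le_radius_coeffSeries (𝕜 := 𝕜) hw hlam hr
  have hr0' : (0 : ℝ≥0∞) < r := by exact_mod_cast hr0
  have h := (coeffSeries (𝕜 := 𝕜) w).hasFPowerSeriesOnBall (hr0'.trans_le hle)
  rw [coeffSeries_sum] at h
  exact h.mono hr0' hle

/-- SUP BOUND: if `‖wₙ‖ ≤ B λⁿ` and `λ‖x‖ < 1` then `‖Σ xⁿ • wₙ‖ ≤ B / (1 − λ‖x‖)`. [folklore] -/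
theorem norm_tsum_pow_smul_le [CompleteSpace F] {w : ℕ → F} {B lam : ℝ} (hw : ∀ n, ‖w n‖ ≤ B * lam ^ n)
    (hlam : 0 ≤ lam) {x : 𝕜} (hx : lam * ‖x‖ < 1) : ‖∑' n, x ^ n • w n‖ ≤ B / (1 - lam * ‖x‖) := by
  have h0 : 0 ≤ lam * ‖x‖ := by positivity
  rw [div_eq_mul_inv]
  refine tsum_of_norm_bounded ((hasSum_geometric_of_lt_one h0 hx).mul_left B) fun n => ?_
  rw [norm_smul, norm_pow, mul_pow]
  calc ‖x‖ ^ n * ‖w n‖ ≤ ‖x‖ ^ n * (B * lam ^ n) := mul_le_mul_of_nonneg_left (hw n) (by positivity)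
    _ = B * (lam ^ n * ‖x‖ ^ n) := by ring

end CoeffSeries

end Literature.Analysis.ODE

end
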